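import Summits.QuantumFields.YangMills.Theorems.BalabanLadderIRcofEquipartitionSeamSliceRealisation
import Summits.QuantumFields.YangMills.Theorems.BalabanLadderIRcofEquipartitionSeamSpectralDict
import Mathlib.Analysis.MeanInequalities
import Mathlib.Analysis.SpecialFunctions.Pow.Real
import HarnessLib

/-!
# Row 47 `equipartition_seam` — stub T (`VacuumSlackV`) follows from ONE eigenvalue-free
# super-multiplicativity bound at aspect ratio 1 : 2 («half-split slack» T♭)

Crux `IRcof` (stmt-QuantumFields-26930), line `Cruxes/IRcof/Lines/equipartition_seam.lean` (skeleton rev 10), stub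
T `stub_vacuumSlackV : KernelCurrency.VacuumSlackV`.  HONEST: nothing here is a constructive-QFT estimate; the
Yang–Mills mass gap (Clay) is NOT proved; `IRcof` ∕ `IR` 0 ∕ 1; the skeleton and the statement of record T are
UNCHANGED.  This file is sorry-free TRANSPORT: it replaces the located stub T (a family of inequalities indexed by the
extent deficit `ϱ ≤ (2S+1)/4`, involving the principal growth rate `λ₊ = limsup Z^{1/m}`) by a single inequality between
THREE HONEST TORUS PARTITION FUNCTIONS of the same `w`-theory in the same magnetic sector,

  T♭ `VacuumSlackHalfOn π w C S_T`:  for `S ≥ S_T` and every sector `z`,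
      `Z_w(elOff z; S × (2S+1)³) · Z_w(elOff z; (S+1) × (2S+1)³) ≤ C · Z_w(elOff z; (2S+1)⁴)`,

i.e. approximate super-multiplicativity of the time-extent-`s` partition function at the split `2S+1 = S + (S+1)`
(equivalently: the vacuum-normalised thermal trace `Σᵢ (λᵢ/λ₊)^{S+1}` of the `(2S+1)³` cube at temperature `1/(S+1)` is
`O(1)`).  No `growthRate`, no `limsup`, no `ϱ`.

Mechanism (solvent cell «transfer-matrix log-convexity × T», interpolating from `m = S`, NOT from `m = 2`): by the
LANDED spectral dictionary D (`KernelCurrency.SpectralDictV`, theorem `SpectralDict.spectralDictV_of_sliceRealisationV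
SliceKernel.sliceRealisationV_holds`) the untwisted traces are power sums `Z(m) = Σᵢ λᵢ^m` (`m ≥ 2`, `λᵢ ≥ 0`), hence
(§1) `m ↦ log Z(m)` is convex — three-point Hölder `Z(b)^{c−a} ≤ Z(a)^{c−b} Z(c)^{b−a}` — and (§2–§3) `λ₊^{S+1} ≤ Z(S+1)`
(`ℓ^m`-norm monotonicity + the `limsup`).  With `a = S`, `b = 2S+1−ϱ`, `c = 2S+1` (§4):
`(λ₊^ϱ Z(2S+1−ϱ))^{S+1} ≤ (λ₊^{S+1})^ϱ Z(S)^ϱ Z(2S+1)^{S+1−ϱ} ≤ (Z(S) Z(S+1))^ϱ Z(2S+1)^{S+1−ϱ} ≤ (max 1 C)^{S+1} Z(2S+1)^{S+1}`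
for EVERY `ϱ ≤ S+1` — so T♭ gives T with the UNIFORM constant `max 1 C` (the `ϱ`-dependence question «T_fix» is moot for
any method proving T♭).  Interpolating from `m = 2` instead would cost the factor `Z̃(2)^{ϱ/(2S−1)}`, unbounded
(crit-3 l.1854); from `m = S` the loss is nil.

T♭ is STRONGER than T (aspect `1 : 2` instead of `3 : 4`); it is NOT claimed equivalent.  Why it is the better-posed
target: it is a finite-size free-energy inequality `F(S) + F(S+1) − F(2S+1) ≥ −log C` between honest partition functions,
measurable by thermodynamic integration and the natural output of any expansion that controls `log Z` to `o(1)` beyond the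
bulk term; its known obstruction is the femto-universe ∕ toron regime (`(2S+1)·a ≲ ξ`), where the normalised trace grows
like a power of `β` — hence the thresholds `S_T(β)` (as in T).

Main results (namespace `Summit.QuantumFields.YangMills.Cruxes.IRcof.EquipartitionSeam.VacuumSlackHalf`):
* `powSum_holder3` — three-point Hölder (log-convexity) for real power sums with natural exponents;
* `powSum_root_anti` — `Z(m)^{1/m} ≤ Z(q)^{1/q}` for `1 ≤ q ≤ m`;
* `growthRate_nonneg_and_pow_le` — from D's datum at `(S, z)`: `0 ≤ λ₊` and `λ₊^{S+1} ≤ Z(S+1)`;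
* `slack_of_half` — the abstract transport `Z(S) Z(S+1) ≤ C Z(2S+1) ⊢ Λ^ϱ Z(2S+1−ϱ) ≤ max 1 C · Z(2S+1)` (`ϱ ≤ S+1`);
* `halfSplit_le_split` — `Z(S)·Z(S+1) ≤ Z(a)·Z(2S+1−a)` for `2 ≤ a ≤ S`: T♭ is the WEAKEST eigenvalue-free split bound at extent `2S+1`;
* `vacuumSlackOn_of_spectralDictOn_of_half` — per `(π, w)`: D beyond `S_D` and T♭ beyond `S_T` give
  `VacuumSlackOn π w (max 1 C) (max (max S_D S_T) 2)`;
* `vacuumSlackV_of_half : VacuumSlackHalfV → KernelCurrency.VacuumSlackV` — unconditional (D is landed).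
Companion `Cruxes/IRcof/Lines/equipartition_seam_VacuumSlackHalfRung.lean`: `wilson_halfSplitSlack_of_strongCoupling` — T♭'s
inequality PROVED (0 sorry) for the untwisted Wilson theory at strong coupling `0 ≤ β ≤ r_ρ`, uniformly in `S`, from the
tree's `coldTraceBound_of_strongCoupling` (wrong regime for row 47; a witness that the SHAPE is right and provable where
`log Z` is controlled to `O(1)` beyond the bulk).
-/

open MeasureTheory Filter Topology
open scoped BigOperators ComplexConjugate

namespace Summit.QuantumFields.YangMills.Cruxes.IRcof.EquipartitionSeam.VacuumSlackHalf

open Literature.MathematicalPhysics.QuantumFieldTheory Literature.MathematicalPhysics.QuantumLattice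
open Summit.QuantumFields.YangMills.Theorems.NonSimplyConnectedLatticeGap
open Summit.QuantumFields.YangMills.Cruxes.IRcof.EquipartitionSeam.KernelCurrency

/-! ## §1 Log-convexity of power sums (three-point Hölder) -/

/-- **Three-point Hölder ∕ Lyapunov inequality for power sums.**  If `λᵢ ≥ 0` and `Z(a) = Σ λᵢ^a`, `Z(b) = Σ λᵢ^b`,
`Z(c) = Σ λᵢ^c` with `a ≤ b ≤ c`, then `Z(b)^{c−a} ≤ Z(a)^{c−b} · Z(c)^{b−a}` (`m ↦ log Z(m)` is convex). -/
theorem powSum_holder3 {ι : Type*} {lam : ι → ℝ} (h0 : ∀ i, 0 ≤ lam i) {a b c : ℕ} (hab : a ≤ b) (hbc : b ≤ c)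
    {Za Zb Zc : ℝ} (hZa : HasSum (fun i => lam i ^ a) Za) (hZb : HasSum (fun i => lam i ^ b) Zb)
    (hZc : HasSum (fun i => lam i ^ c) Zc) : Zb ^ (c - a) ≤ Za ^ (c - b) * Zc ^ (b - a) := by
  have hZa0 : 0 ≤ Za := hZa.nonneg fun i => pow_nonneg (h0 i) _
  have hZb0 : 0 ≤ Zb := hZb.nonneg fun i => pow_nonneg (h0 i) _
  have hZc0 : 0 ≤ Zc := hZc.nonneg fun i => pow_nonneg (h0 i) _
  rcases Nat.eq_or_lt_of_le hab with hab' | hab'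
  · subst hab'
    have hu : Zb = Za := hZb.unique hZa
    subst hu
    simp
  rcases Nat.eq_or_lt_of_le hbc with hbc' | hbc'
  · subst hbc'
    have hu : Zc = Zb := hZc.unique hZb
    subst hu
    simp
  -- main case `a < b < c`: Hölder with `θ = (c - b)/(c - a) ∈ (0, 1)`, `p = 1/θ`, `q = 1/(1 - θ)`
  have hca : (0 : ℝ) < (c : ℝ) - a := by
    have : (a : ℝ) < c := by exact_mod_cast hab'.trans hbc'
    linarith
  have hcb : (0 : ℝ) < (c : ℝ) - b := by
    have : (b : ℝ) < c := by exact_mod_cast hbc'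
    linarith
  have hba : (0 : ℝ) < (b : ℝ) - a := by
    have : (a : ℝ) < b := by exact_mod_cast hab'
    linarith
  set θ : ℝ := ((c : ℝ) - b) / ((c : ℝ) - a) with hθ
  have hθ0 : 0 < θ := div_pos hcb hca
  have hθ1 : θ < 1 := (div_lt_one hca).2 (by linarith)
  have h1θ : 0 < 1 - θ := by linarith
  have hθdef : θ * ((c : ℝ) - a) = (c : ℝ) - b := div_mul_cancel₀ _ hca.ne'
  have hpq : θ⁻¹.HolderConjugate (1 - θ)⁻¹ := Real.HolderConjugate.inv_one_sub_inv hθ0 hθ1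
  -- the two Hölder factors
  have hf0 : ∀ i, 0 ≤ (lam i ^ a) ^ θ := fun i => Real.rpow_nonneg (pow_nonneg (h0 i) a) θ
  have hg0 : ∀ i, 0 ≤ (lam i ^ c) ^ (1 - θ) := fun i => Real.rpow_nonneg (pow_nonneg (h0 i) c) _
  have hfp : ∀ i, ((lam i ^ a) ^ θ) ^ θ⁻¹ = lam i ^ a := fun i => by
    rw [← Real.rpow_mul (pow_nonneg (h0 i) a), mul_inv_cancel₀ hθ0.ne', Real.rpow_one]
  have hgq : ∀ i, ((lam i ^ c) ^ (1 - θ)) ^ (1 - θ)⁻¹ = lam i ^ c := fun i => by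
    rw [← Real.rpow_mul (pow_nonneg (h0 i) c), mul_inv_cancel₀ h1θ.ne', Real.rpow_one]
  have hfg : ∀ i, (lam i ^ a) ^ θ * (lam i ^ c) ^ (1 - θ) = lam i ^ b := fun i => by
    rw [← Real.rpow_natCast (lam i) a, ← Real.rpow_natCast (lam i) c, ← Real.rpow_natCast (lam i) b,
      ← Real.rpow_mul (h0 i), ← Real.rpow_mul (h0 i),
      ← Real.rpow_add_of_nonneg (h0 i) (by positivity) (by positivity)]
    congr 1
    linear_combination (-1 : ℝ) * hθdef
  have hfsum : Summable fun i => ((lam i ^ a) ^ θ) ^ θ⁻¹ := by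
    simp_rw [hfp]; exact hZa.summable
  have hgsum : Summable fun i => ((lam i ^ c) ^ (1 - θ)) ^ (1 - θ)⁻¹ := by
    simp_rw [hgq]; exact hZc.summable
  have hH := Real.inner_le_Lp_mul_Lq_tsum_of_nonneg hpq hf0 hg0 hfsum hgsum
  simp_rw [hfg, hfp, hgq, hZa.tsum_eq, hZb.tsum_eq, hZc.tsum_eq, one_div, inv_inv] at hH
  -- `hH : Zb ≤ Za ^ θ * Zc ^ (1 - θ)`; raise to the natural power `c - a`
  have e1 : (Za ^ θ) ^ (c - a) = Za ^ (c - b) := by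
    rw [← Real.rpow_natCast (Za ^ θ) (c - a), ← Real.rpow_mul hZa0, ← Real.rpow_natCast Za (c - b)]
    congr 1
    rw [Nat.cast_sub (hab'.trans hbc').le, Nat.cast_sub hbc]
    exact hθdef
  have e2 : (Zc ^ (1 - θ)) ^ (c - a) = Zc ^ (b - a) := by
    rw [← Real.rpow_natCast (Zc ^ (1 - θ)) (c - a), ← Real.rpow_mul hZc0, ← Real.rpow_natCast Zc (b - a)]
    congr 1
    rw [Nat.cast_sub (hab'.trans hbc').le, Nat.cast_sub hab]
    linear_combination (-1 : ℝ) * hθdef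
  calc Zb ^ (c - a) ≤ (Za ^ θ * Zc ^ (1 - θ)) ^ (c - a) := pow_le_pow_left₀ hZb0 hH _
    _ = Za ^ (c - b) * Zc ^ (b - a) := by rw [mul_pow, e1, e2]

/-! ## §2 Monotonicity of `ℓ^m` roots -/

/-- **`Z(m)^{1/m} ≤ Z(q)^{1/q}` for `1 ≤ q ≤ m`** (`ℓ^m`-norm ≤ `ℓ^q`-norm of the sequence `λ`). -/
theorem powSum_root_anti {ι : Type*} {lam : ι → ℝ} (h0 : ∀ i, 0 ≤ lam i) {q m : ℕ} (hq : 1 ≤ q) (hqm : q ≤ m)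
    {Zq Zm : ℝ} (hZq : HasSum (fun i => lam i ^ q) Zq) (hZm : HasSum (fun i => lam i ^ m) Zm) :
    Zm ^ ((m : ℝ)⁻¹) ≤ Zq ^ ((q : ℝ)⁻¹) := by
  have hZq0 : 0 ≤ Zq := hZq.nonneg fun i => pow_nonneg (h0 i) _
  have hZm0 : 0 ≤ Zm := hZm.nonneg fun i => pow_nonneg (h0 i) _
  have hM0 : 0 ≤ Zq ^ ((q : ℝ)⁻¹) := Real.rpow_nonneg hZq0 _
  have hq0 : q ≠ 0 := by omega
  have hm0 : m ≠ 0 := by omega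
  -- each `λᵢ ≤ M := Z(q)^{1/q}`
  have hle : ∀ i, lam i ≤ Zq ^ ((q : ℝ)⁻¹) := fun i => by
    have h1 : lam i ^ q ≤ Zq := le_hasSum hZq i fun j _ => pow_nonneg (h0 j) _
    calc lam i = (lam i ^ q) ^ ((q : ℝ)⁻¹) := (Real.pow_rpow_inv_natCast (h0 i) hq0).symm
      _ ≤ Zq ^ ((q : ℝ)⁻¹) := Real.rpow_le_rpow (pow_nonneg (h0 i) _) h1 (by positivity)
  -- `Z(m) ≤ M^m`
  have hMq : (Zq ^ ((q : ℝ)⁻¹)) ^ q = Zq := Real.rpow_inv_natCast_pow hZq0 hq0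
  have hZmle : Zm ≤ (Zq ^ ((q : ℝ)⁻¹)) ^ m := by
    have h1 : HasSum (fun i => (Zq ^ ((q : ℝ)⁻¹)) ^ (m - q) * lam i ^ q) ((Zq ^ ((q : ℝ)⁻¹)) ^ (m - q) * Zq) :=
      hZq.mul_left _
    have h2 : ∀ i, lam i ^ m ≤ (Zq ^ ((q : ℝ)⁻¹)) ^ (m - q) * lam i ^ q := fun i =>
      calc lam i ^ m = lam i ^ (m - q) * lam i ^ q := by rw [← pow_add, Nat.sub_add_cancel hqm]
        _ ≤ (Zq ^ ((q : ℝ)⁻¹)) ^ (m - q) * lam i ^ q :=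
          mul_le_mul_of_nonneg_right (pow_le_pow_left₀ (h0 i) (hle i) _) (pow_nonneg (h0 i) _)
    calc Zm ≤ (Zq ^ ((q : ℝ)⁻¹)) ^ (m - q) * Zq := hasSum_le h2 hZm h1
      _ = (Zq ^ ((q : ℝ)⁻¹)) ^ (m - q) * (Zq ^ ((q : ℝ)⁻¹)) ^ q := by rw [hMq]
      _ = (Zq ^ ((q : ℝ)⁻¹)) ^ m := by rw [← pow_add, Nat.sub_add_cancel hqm]
  calc Zm ^ ((m : ℝ)⁻¹) ≤ ((Zq ^ ((q : ℝ)⁻¹)) ^ m) ^ ((m : ℝ)⁻¹) :=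
        Real.rpow_le_rpow hZm0 hZmle (by positivity)
    _ = Zq ^ ((q : ℝ)⁻¹) := Real.pow_rpow_inv_natCast hM0 hm0

/-! ## §3 The principal growth rate is dominated by one torus partition function -/

section PerWeight

variable {G H : Type} [Group G] [TopologicalSpace G] [MeasurableSpace G] [Group H] [TopologicalSpace H]
  [IsTopologicalGroup H] [CompactSpace H] [MeasurableSpace H] [BorelSpace H]

omit [TopologicalSpace G] in
/-- From D at `(S, z)`: the untwisted traces are real power sums `Z_w(elOff z; m) = Σᵢ λᵢ^m` (`m ≥ 2`) with
`0 ≤ λᵢ ≤ λ₊(z; S)` (as in the g8 workfile `equipartition_seam_VacuumSlackMono.lean`, re-proved here to keep this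
file self-contained). -/
theorem exists_hasSum_pow_of_spectralDictOn {π : H →* G} {w : H → ℝ} {thick : YMSpecies G → ℕ}
    {nrm : YMSpecies G → ℝ} {S_D : ℕ} (hD : SpectralDictOn π w thick nrm S_D) {S : ℕ} (hS : S_D ≤ S)
    (z : Sector π) :
    ∃ (ι : Type) (lam : ι → ℝ), (∀ i, 0 ≤ lam i ∧ lam i ≤ growthRate π w z S) ∧
      ∀ m : ℕ, 2 ≤ m → HasSum (fun i => lam i ^ m) (secZ π w (elOff π z) S m) := by
  obtain ⟨ι, lam, χ, hlam, hχmul, hχnorm, hZ, -⟩ := hD S hS z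
  have hχ1 : ∀ i, χ i 1 = 1 := fun i => by
    have hne : χ i 1 ≠ 0 := fun h0 => by
      have h := hχnorm i 1; rw [h0, norm_zero] at h; exact zero_ne_one h
    have h1 : χ i 1 * χ i 1 = χ i 1 * 1 := by rw [mul_one, ← hχmul, mul_one]
    exact mul_left_cancel₀ hne h1
  refine ⟨ι, lam, hlam, fun m hm => ?_⟩
  have h := hZ m hm 1
  simp_rw [hχ1, one_mul] at h
  have h' : HasSum (fun i => ((lam i ^ m : ℝ) : ℂ)) ((secZ π w (withEl π z 1) S m : ℝ) : ℂ) := h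
  exact Complex.hasSum_ofReal.mp h'

omit [TopologicalSpace G] [MeasurableSpace G] in
/-- **`0 ≤ λ₊(z;S)` and `λ₊(z;S)^{S+1} ≤ Z_w(elOff z; S+1)`** from a power-sum datum at `(S, z)` (`S ≥ 1`):
every term of the `limsup` defining `growthRate` beyond `m = S` is `Z(m+1)^{1/(m+1)} ≤ Z(S+1)^{1/(S+1)}` (§2). -/
theorem growthRate_nonneg_and_pow_le {π : H →* G} {w : H → ℝ} {S : ℕ} {z : Sector π} {ι : Type} {lam : ι → ℝ}
    (h0 : ∀ i, 0 ≤ lam i) (hZ : ∀ m : ℕ, 2 ≤ m → HasSum (fun i => lam i ^ m) (secZ π w (elOff π z) S m))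
    (hS : 1 ≤ S) :
    0 ≤ growthRate π w z S ∧ growthRate π w z S ^ (S + 1) ≤ secZ π w (elOff π z) S (S + 1) := by
  have hq : 2 ≤ S + 1 := by omega
  have hZS0 : 0 ≤ secZ π w (elOff π z) S (S + 1) := (hZ _ hq).nonneg fun i => pow_nonneg (h0 i) _
  have hup : ∀ᶠ m : ℕ in atTop, (secZ π w (elOff π z) S (m + 1)) ^ (((m : ℝ) + 1)⁻¹) ≤
      secZ π w (elOff π z) S (S + 1) ^ (((S + 1 : ℕ) : ℝ)⁻¹) := by
    filter_upwards [eventually_ge_atTop S] with m hm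
    have h := powSum_root_anti h0 (q := S + 1) (m := m + 1) (by omega) (by omega) (hZ _ hq) (hZ _ (by omega))
    have hc : ((m : ℝ) + 1) = ((m + 1 : ℕ) : ℝ) := by push_cast; ring
    rw [hc]; exact h
  have hlow : ∀ᶠ m : ℕ in atTop, 0 ≤ (secZ π w (elOff π z) S (m + 1)) ^ (((m : ℝ) + 1)⁻¹) := by
    filter_upwards [eventually_ge_atTop 1] with m hm
    exact Real.rpow_nonneg ((hZ _ (by omega)).nonneg fun i => pow_nonneg (h0 i) _) _
  have hbdd : IsBoundedUnder (· ≤ ·) atTop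
      (fun m : ℕ => (secZ π w (elOff π z) S (m + 1)) ^ (((m : ℝ) + 1)⁻¹)) := isBoundedUnder_of_eventually_le hup
  have hcob : IsCoboundedUnder (· ≤ ·) atTop
      (fun m : ℕ => (secZ π w (elOff π z) S (m + 1)) ^ (((m : ℝ) + 1)⁻¹)) :=
    isCoboundedUnder_le_of_eventually_le atTop hlow
  have hle : growthRate π w z S ≤ secZ π w (elOff π z) S (S + 1) ^ (((S + 1 : ℕ) : ℝ)⁻¹) :=
    limsup_le_of_le hcob hup
  have hge : 0 ≤ growthRate π w z S := le_limsup_of_frequently_le hlow.frequently hbdd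
  refine ⟨hge, ?_⟩
  calc growthRate π w z S ^ (S + 1) ≤ (secZ π w (elOff π z) S (S + 1) ^ (((S + 1 : ℕ) : ℝ)⁻¹)) ^ (S + 1) :=
        pow_le_pow_left₀ hge hle _
    _ = secZ π w (elOff π z) S (S + 1) := Real.rpow_inv_natCast_pow hZS0 (by omega)

end PerWeight

/-! ## §4 The abstract transport: half-split slack ⟹ every deficit `ϱ ≤ S+1`, uniform constant -/

/-- **Transport lemma.**  For a power-sum sequence `Z(m) = Σ λᵢ^m` (`m ≥ 2`, `λᵢ ≥ 0`), `S ≥ 2`, any `Λ ≥ 0` with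
`Λ^{S+1} ≤ Z(S+1)` and the half-split bound `Z(S) Z(S+1) ≤ C Z(2S+1)`:
`Λ^ϱ · Z(2S+1−ϱ) ≤ max 1 C · Z(2S+1)` for every `ϱ ≤ S+1`.  (Hölder from `m = S`: lossless.) -/
theorem slack_of_half {ι : Type*} {lam : ι → ℝ} (h0 : ∀ i, 0 ≤ lam i) {Z : ℕ → ℝ}
    (hZ : ∀ m : ℕ, 2 ≤ m → HasSum (fun i => lam i ^ m) (Z m)) {S : ℕ} (hS : 2 ≤ S) {Λ C : ℝ} (hΛ : 0 ≤ Λ)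
    (hΛS : Λ ^ (S + 1) ≤ Z (S + 1)) (hH : Z S * Z (S + 1) ≤ C * Z (2 * S + 1)) {ϱ : ℕ} (hϱ : ϱ ≤ S + 1) :
    Λ ^ ϱ * Z (2 * S + 1 - ϱ) ≤ max 1 C * Z (2 * S + 1) := by
  have hZ0 : ∀ m, 2 ≤ m → 0 ≤ Z m := fun m hm => (hZ m hm).nonneg fun i => pow_nonneg (h0 i) _
  have hC1 : 1 ≤ max 1 C := le_max_left _ _
  have hC0 : 0 ≤ max 1 C := zero_le_one.trans hC1
  have ht0 : 0 ≤ Z (2 * S + 1) := hZ0 _ (by omega)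
  have hH' : Z S * Z (S + 1) ≤ max 1 C * Z (2 * S + 1) :=
    hH.trans (mul_le_mul_of_nonneg_right (le_max_right _ _) ht0)
  -- Hölder with `a = S`, `b = 2S+1-ϱ`, `c = 2S+1`
  have hHol := powSum_holder3 h0 (a := S) (b := 2 * S + 1 - ϱ) (c := 2 * S + 1) (by omega) (by omega)
    (hZ _ hS) (hZ _ (by omega)) (hZ _ (by omega))
  have e1 : 2 * S + 1 - S = S + 1 := by omega
  have e2 : 2 * S + 1 - (2 * S + 1 - ϱ) = ϱ := by omega
  have e3 : 2 * S + 1 - ϱ - S = S + 1 - ϱ := by omega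
  rw [e1, e2, e3] at hHol
  -- `hHol : Z (2S+1-ϱ) ^ (S+1) ≤ Z S ^ ϱ * Z (2S+1) ^ (S+1-ϱ)`
  have hX0 : 0 ≤ Λ ^ ϱ * Z (2 * S + 1 - ϱ) := mul_nonneg (pow_nonneg hΛ _) (hZ0 _ (by omega))
  have key : (Λ ^ ϱ * Z (2 * S + 1 - ϱ)) ^ (S + 1) ≤ (max 1 C * Z (2 * S + 1)) ^ (S + 1) :=
    calc (Λ ^ ϱ * Z (2 * S + 1 - ϱ)) ^ (S + 1)
        = (Λ ^ (S + 1)) ^ ϱ * Z (2 * S + 1 - ϱ) ^ (S + 1) := by ring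
      _ ≤ Z (S + 1) ^ ϱ * (Z S ^ ϱ * Z (2 * S + 1) ^ (S + 1 - ϱ)) :=
          mul_le_mul (pow_le_pow_left₀ (pow_nonneg hΛ _) hΛS _) hHol (pow_nonneg (hZ0 _ (by omega)) _)
            (pow_nonneg (hZ0 _ (by omega)) _)
      _ = (Z S * Z (S + 1)) ^ ϱ * Z (2 * S + 1) ^ (S + 1 - ϱ) := by ring
      _ ≤ (max 1 C * Z (2 * S + 1)) ^ ϱ * Z (2 * S + 1) ^ (S + 1 - ϱ) :=
          mul_le_mul_of_nonneg_right (pow_le_pow_left₀ (mul_nonneg (hZ0 _ hS) (hZ0 _ (by omega))) hH' _)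
            (pow_nonneg ht0 _)
      _ = (max 1 C) ^ ϱ * Z (2 * S + 1) ^ (S + 1) := by
          rw [mul_pow, mul_assoc, ← pow_add, Nat.add_sub_cancel' hϱ]
      _ ≤ (max 1 C) ^ (S + 1) * Z (2 * S + 1) ^ (S + 1) :=
          mul_le_mul_of_nonneg_right (pow_le_pow_right₀ hC1 hϱ) (pow_nonneg ht0 _)
      _ = (max 1 C * Z (2 * S + 1)) ^ (S + 1) := by rw [mul_pow]
  exact (pow_le_pow_iff_left₀ hX0 (mul_nonneg hC0 ht0) (by omega : S + 1 ≠ 0)).mp key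

/-! ## §4b T♭ is the WEAKEST split inequality: `Z(S)·Z(S+1) ≤ Z(a)·Z(2S+1−a)` for `2 ≤ a ≤ S` -/

/-- **The symmetric split is the smallest.**  For power sums with `λᵢ ≥ 0`, log-convexity gives
`Z(S)·Z(S+1) ≤ Z(a)·Z(2S+1−a)` whenever `2 ≤ a ≤ S`.  Hence ANY eigenvalue-free split bound
`Z(a)·Z(2S+1−a) ≤ C·Z(2S+1)` at time extent `2S+1` implies T♭'s `Z(S)·Z(S+1) ≤ C·Z(2S+1)` with the SAME constant:
among the split inequalities T♭ (aspect `1 : 2`) is the canonical — weakest — member, not an arbitrary choice. -/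
theorem halfSplit_le_split {ι : Type*} {lam : ι → ℝ} (h0 : ∀ i, 0 ≤ lam i) {Z : ℕ → ℝ}
    (hZ : ∀ m : ℕ, 2 ≤ m → HasSum (fun i => lam i ^ m) (Z m)) {S a : ℕ} (ha : 2 ≤ a) (haS : a ≤ S) :
    Z S * Z (S + 1) ≤ Z a * Z (2 * S + 1 - a) := by
  have hZ0 : ∀ m, 2 ≤ m → 0 ≤ Z m := fun m hm => (hZ m hm).nonneg fun i => pow_nonneg (h0 i) _
  -- Hölder at `(a, S, b')` and at `(a, S+1, b')`, `b' = 2S+1-a`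
  have h1 := powSum_holder3 h0 (a := a) (b := S) (c := 2 * S + 1 - a) haS (by omega)
    (hZ _ ha) (hZ _ (by omega)) (hZ _ (by omega))
  have h2 := powSum_holder3 h0 (a := a) (b := S + 1) (c := 2 * S + 1 - a) (by omega) (by omega)
    (hZ _ ha) (hZ _ (by omega)) (hZ _ (by omega))
  have e2 : (2 * S + 1 - a - S) + (2 * S + 1 - a - (S + 1)) = 2 * S + 1 - a - a := by omega
  have e3 : (S - a) + (S + 1 - a) = 2 * S + 1 - a - a := by omega
  have hL0 : 0 ≤ Z S * Z (S + 1) := mul_nonneg (hZ0 _ (by omega)) (hZ0 _ (by omega))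
  have hR0 : 0 ≤ Z a * Z (2 * S + 1 - a) := mul_nonneg (hZ0 _ ha) (hZ0 _ (by omega))
  have key : (Z S * Z (S + 1)) ^ (2 * S + 1 - a - a) ≤ (Z a * Z (2 * S + 1 - a)) ^ (2 * S + 1 - a - a) :=
    calc (Z S * Z (S + 1)) ^ (2 * S + 1 - a - a)
        = Z S ^ (2 * S + 1 - a - a) * Z (S + 1) ^ (2 * S + 1 - a - a) := mul_pow _ _ _
      _ ≤ (Z a ^ (2 * S + 1 - a - S) * Z (2 * S + 1 - a) ^ (S - a)) *
            (Z a ^ (2 * S + 1 - a - (S + 1)) * Z (2 * S + 1 - a) ^ (S + 1 - a)) :=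
          mul_le_mul h1 h2 (pow_nonneg (hZ0 _ (by omega)) _)
            (mul_nonneg (pow_nonneg (hZ0 _ ha) _) (pow_nonneg (hZ0 _ (by omega)) _))
      _ = Z a ^ ((2 * S + 1 - a - S) + (2 * S + 1 - a - (S + 1))) *
            Z (2 * S + 1 - a) ^ ((S - a) + (S + 1 - a)) := by ring
      _ = (Z a * Z (2 * S + 1 - a)) ^ (2 * S + 1 - a - a) := by rw [e2, e3, mul_pow]
  exact (pow_le_pow_iff_left₀ hL0 hR0 (by omega : 2 * S + 1 - a - a ≠ 0)).mp key

/-! ## §5 The per-`(π, w)` statement T♭ and the reduction T♭ ⟹ T -/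

section PerWeight

variable {G H : Type} [Group G] [TopologicalSpace G] [MeasurableSpace G] [Group H] [TopologicalSpace H]
  [IsTopologicalGroup H] [CompactSpace H] [MeasurableSpace H] [BorelSpace H]

/-- **T♭ at one `w`: HALF-SPLIT VACUUM SLACK beyond `S_T` with constant `C`** — for `S ≥ S_T` and every sector
`z`: `Z_w(elOff z; S) · Z_w(elOff z; S+1) ≤ C · Z_w(elOff z; 2S+1)` (all three on the spatial cube `(2S+1)³`, time
extents `S`, `S+1`, `2S+1`; the magnetic part of `z` kept, the electric part switched off).  Eigenvalue-free. -/
def VacuumSlackHalfOn (π : H →* G) (w : H → ℝ) (C : ℝ) (S_T : ℕ) : Prop :=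
  ∀ S : ℕ, S_T ≤ S → ∀ z : Sector π,
    secZ π w (elOff π z) S S * secZ π w (elOff π z) S (S + 1) ≤ C * secZ π w (elOff π z) S (2 * S + 1)

omit [TopologicalSpace G] in
/-- **The per-weight reduction T♭ ⟹ T.**  D beyond `S_D` and the half-split slack beyond `S_T` give the full vacuum
slack T beyond `max (max S_D S_T) 2`, for EVERY deficit `ϱ` with `4ϱ ≤ 2S+1` (indeed for every `ϱ ≤ S+1`), with the
uniform constant `max 1 C`. -/
theorem vacuumSlackOn_of_spectralDictOn_of_half {π : H →* G} {w : H → ℝ} {thick : YMSpecies G → ℕ}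
    {nrm : YMSpecies G → ℝ} {S_D : ℕ} (hD : SpectralDictOn π w thick nrm S_D) {C : ℝ} {S_T : ℕ}
    (hH : VacuumSlackHalfOn π w C S_T) : VacuumSlackOn π w (max 1 C) (max (max S_D S_T) 2) := by
  intro S hS z ϱ hϱ
  have hSD : S_D ≤ S := ((le_max_left _ _).trans (le_max_left _ _)).trans hS
  have hST : S_T ≤ S := ((le_max_right _ _).trans (le_max_left _ _)).trans hS
  have hS2 : 2 ≤ S := (le_max_right _ _).trans hS
  obtain ⟨ι, lam, hlam, hZ⟩ := exists_hasSum_pow_of_spectralDictOn hD hSD z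
  have h0 : ∀ i, 0 ≤ lam i := fun i => (hlam i).1
  obtain ⟨hΛ0, hΛS⟩ := growthRate_nonneg_and_pow_le h0 hZ (by omega)
  exact slack_of_half h0 (Z := fun m => secZ π w (elOff π z) S m) hZ hS2 hΛ0 hΛS (hH S hST z) (by omega)

end PerWeight

/-! ## §6 The `V`-level statement T♭ and the unconditional reduction (D is landed) -/

/-- **T♭ `VacuumSlackHalfV`** — HALF-SPLIT VACUUM SLACK for every admissible split weight: beyond thresholds `β_T`,
`S_T β`, one constant `C > 0` with `Z_w(elOff z; S) · Z_w(elOff z; S+1) ≤ C · Z_w(elOff z; 2S+1)` for every `S ≥ S_T β`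
and every sector `z`.  Same outer binders as `KernelCurrency.VacuumSlackV`.  LOCATED and STRONGER than T (aspect ratio
`1 : 2` instead of `3 : 4`): a finite-size thermal free-energy bound of the `w`-theory in the untwisted magnetic
sectors, uniform in the volume along `β → ∞`, `S ≥ S_T(β)`.  In the ratio `Z(S)·Z(S+1)/Z(2S+1)` the BULK free energy
cancels identically (the time extents add up), so T♭ bounds a pure finite-size term.  Why it might fail: the only known
obstruction is the femto-universe ∕ toron regime — at FIXED `S` the normalised trace `Σᵢ (λᵢ/λ₊)^{S+1}` grows like a
power of `β` (zero-mode spectrum `E_n ≍ g^{2/3}/L`), so `S_T(β) → ∞` is necessary; beyond it the term is `O(e^{−mS})`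
in the confined regime and, by Stefan–Boltzmann scaling (`ε/T⁴ ≤ κ = (N²−1)π²/15`, arXiv:hep-lat/0001009 p. 2),
still `O(L³T³ · p/T⁴) = O(10)` for `SU(2)` even inside a deconfined window `S+1 < N_{τ,c}(β)` — bounded, not small.
The bet is `S_T(β) ≍ c·ξ(β)` with ONE `C`; the wall is proving any of this at weak coupling, not its plausibility. -/
def VacuumSlackHalfV : Prop :=
  ∀ (G : Type) [Group G] [TopologicalSpace G] [IsTopologicalGroup G] [CompactSpace G] [MeasurableSpace G]
    [BorelSpace G], IsCompactSimpleLieGroup G → ∀ (H : Type) [Group H] [TopologicalSpace H] [IsTopologicalGroup H]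
    [CompactSpace H] [MeasurableSpace H] [BorelSpace H], IsCompactSimpleLieGroup H → SimplyConnectedSpace H →
    ∀ (π : H →* G), Continuous π → Function.Surjective π → π.ker ≤ Subgroup.center H → (π.ker : Set H).Finite →
    π.ker ≠ ⊥ → ∀ (ρH : LatticeRep H) (r : LatticeRep G) (c : ℝ → ℝ), Tendsto (fun β => c β * β) atTop atTop →
      ∃ (C β_T : ℝ) (S_T : ℝ → ℕ), 0 < C ∧ ∀ β : ℝ, β_T ≤ β → ∀ w : H → ℝ, TwistSplitWeight π ρH r (c β) β w →
        VacuumSlackHalfOn π w C (S_T β)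

/-- **T ⟸ T♭, unconditionally** (the spectral dictionary D is the landed theorem
`SpectralDict.spectralDictV_of_sliceRealisationV SliceKernel.sliceRealisationV_holds`, p696729 + p703079). -/
theorem vacuumSlackV_of_half (hT : VacuumSlackHalfV) : KernelCurrency.VacuumSlackV := by
  intro G _ _ _ _ _ _ hG H _ _ _ _ _ _ hH hsc π hπc hπs hker hfin hne ρH r c hc
  have hD : KernelCurrency.SpectralDictV :=
    SpectralDict.spectralDictV_of_sliceRealisationV SliceKernel.sliceRealisationV_holds
  obtain ⟨thick, nrm, β_D, S_D, hDmain⟩ := hD G hG H hH hsc π hπc hπs hker hfin hne ρH r c hc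
  obtain ⟨C, β_T, S_T, -, hTmain⟩ := hT G hG H hH hsc π hπc hπs hker hfin hne ρH r c hc
  refine ⟨max 1 C, max β_D β_T, fun β => max (max (S_D β) (S_T β)) 2, lt_max_of_lt_left one_pos,
    fun β hβ w hw => ?_⟩
  exact vacuumSlackOn_of_spectralDictOn_of_half (hDmain β ((le_max_left _ _).trans hβ) w hw)
    (hTmain β ((le_max_right _ _).trans hβ) w hw)

end Summit.QuantumFields.YangMills.Cruxes.IRcof.EquipartitionSeam.VacuumSlackHalf
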